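import Summits.CriticalPhenomena.PercolationContinuityZ3.Theorems.PercNearOneGluingNoHeavyLowerTailSunflowerCompositionOuter
import HarnessLib
import HarnessLib.Audit

/-!
# `NoHeavyLowerTail` (crux stmt-CriticalPhenomena-4575), abstract sunflower cubic: COMB IS SUBSTITUTION-CLOSED —
# the fibre-level composition identity `ZF_κ(G ∘ h)(c) = Σ_k (Π_i m_i(c|_i, k_i)) · ZF_κ(G)(k)`

Support file (seat `prim-l12-p2` gen 11; `--supports stmt-CriticalPhenomena-4575`).  Nothing is asserted about the crux; no `sorry`, no
named facts.  Memo: run/shared/lean/prim/prim-l12/prim-l12-p2/FINDING-g11-INDUCTION-NOGO-AND-COMB-CLOSURE.md.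

SETTING (gen 9 `…SunflowerComposition`): a sunflower of up-sets `G` on a finite block-index set `ι` (a monotone map `2^ι → M₃`), monotone
Boolean gadgets `h i` on disjoint finite blocks `β i`, the block substitution `G ∘ h` on `Σ i, β i` (`Sunflower.compose`), and for an
integer kernel `κ` on label triples the FIBRE SUMS `ZF κ F c` = the tensor-Bernstein coefficient of the three-copy functional of `κ` at `F`
with profile `c` (sum of `κ` over the pattern families `J : α → 2^{Fin 3}` with `|J a| = c a`; `COMB_κ(F)` ⟺ all `ZF κ F c ≥ 0`).  Gen 9 proved the
identity for the PARTITION functional (`Zp = ZF` at profile `≡ 1`): `Zκ(G ∘ h) = Σ_k (Π n_i(k_i))·ZF_κ(G)(k)`, hence `COMB(G) ⟹ ★(G ∘ h)`.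

THIS FILE: the same identity for EVERY fibre of the composition (memo FINDING-g10 §2, there stated in one line):
* `ipat` — the pattern INDUCED on block `i` by a pattern family `Y` on the block: the copies whose hit set switches the gadget on;
  `Sunflower.KJ_compose` — the kernel term of `G ∘ h` at a pattern family `JJ` is the kernel term of `G` at the induced block patterns;
* `mcount hi ci K` — the number of pattern families on one block with card-profile `ci` and induced pattern `K`; it depends on `K` only
  through `|K|` (`mcount_eq_mcard`, relabelling the three copies);
* **`Sunflower.ZF_compose_eq`** — `ZF κ (G ∘ h) c = Σ_K (Π_i mcard (h i) (c|_i) |K i|) · KJ κ G K`, and regrouped by profile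
  **`Sunflower.ZF_compose_eq_sum_ZF`** — `= Σ_k (Π_i mcard (h i) (c|_i) (k i)) · ZF κ G k` with NONNEGATIVE integer weights;
* **`Sunflower.ZF_compose_nonneg_of_comb`** — `COMB_κ(G) ⟹ COMB_κ(G ∘ h)`: comb-positivity is closed under every block substitution of
  monotone Boolean gadgets (for every kernel; in particular for `s6H`, `s6G`, `s6T`).
CONSEQUENCE for the programme: COMB (hence the partition lemmas ★_H/★_G/★_T and, through the tree, `H_{q+t}`, `γ`, `G₄`) holds on the whole
substitution closure of any class of sunflowers on which COMB is verified — e.g. every iterated modular composition of the outer maps `θ`, `θ'`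
(`comb_prodOuter_*`, `comb_starOuter_*`) and of sunflowers on `≤ 5` points (COMB census, memo FINDING-g10 §2 C1); equivalently the partition
lemma reduces to COMB for PRIME (module-free) sunflowers.  The one-step pointwise Latin induction, by contrast, admits NO certificate even
with the whole candidate cone of valid one-pinned-coordinate inequalities and all spectator-Gladkov two-copy rows (memo §1, no-go N5).
-/

namespace Summit.CriticalPhenomena.PercolationContinuityZ3.Theorems.SunflowerPartition

open Finset

/-! ## Induced block patterns -/

section Induced

variable {B : Type*} [Fintype B] [DecidableEq B]

/-- The pattern INDUCED on one block by a pattern family `Y : B → 2^{Fin 3}` under the gadget `hi`: the copies `k` whose hit set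
`{b | k ∈ Y b}` switches the block on. (For `Y = singleton ∘ y` this is gen 9's `pat hi y`.) [this work] -/
def ipat (hi : Finset B → Bool) (Y : B → Finset (Fin 3)) : Finset (Fin 3) := univ.filter fun k => hi (hs Y k) = true

omit [DecidableEq B] in
/-- Membership in the induced pattern. [this work] -/
@[simp] theorem mem_ipat (hi : Finset B → Bool) (Y : B → Finset (Fin 3)) (k : Fin 3) :
    k ∈ ipat hi Y ↔ hi (hs Y k) = true := by
  simp [ipat]

omit [DecidableEq B] in
/-- Relabelling the copies by `σ` (imagewise) pulls the hit sets back along `σ⁻¹`. [this work] -/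
theorem hs_image_comp (σ : Equiv.Perm (Fin 3)) (Y : B → Finset (Fin 3)) (k : Fin 3) :
    hs (fun b => (Y b).image σ) k = hs Y (σ.symm k) := by
  ext b
  simp only [hs, mem_filter, mem_univ, true_and, mem_image]
  constructor
  · rintro ⟨a, ha, hak⟩
    rw [← hak]; simpa using ha
  · intro h
    exact ⟨σ.symm k, h, by simp⟩

omit [DecidableEq B] in
/-- Relabelling the copies maps the induced pattern to its image. [this work] -/
theorem ipat_image_comp (hi : Finset B → Bool) (σ : Equiv.Perm (Fin 3)) (Y : B → Finset (Fin 3)) :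
    ipat hi (fun b => (Y b).image σ) = (ipat hi Y).image σ := by
  ext k
  rw [mem_ipat, hs_image_comp, mem_image]
  constructor
  · intro h
    exact ⟨σ.symm k, by rw [mem_ipat]; exact h, by simp⟩
  · rintro ⟨a, ha, rfl⟩
    rw [mem_ipat] at ha
    simpa using ha

/-- Relabelling the copies preserves the card-profile. [this work] -/
theorem card_image_perm (σ : Equiv.Perm (Fin 3)) (S : Finset (Fin 3)) : (S.image σ).card = S.card :=
  card_image_of_injective S σ.injective

/-- The number of pattern families on the block with a prescribed card-profile `ci` and a prescribed induced pattern `K`. [this work] -/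
def mcount (hi : Finset B → Bool) (ci : B → ℕ) (K : Finset (Fin 3)) : ℕ :=
  #(univ.filter fun Y : B → Finset (Fin 3) => (fun b => (Y b).card) = ci ∧ ipat hi Y = K)

/-- The block count is invariant under relabelling the copies. [this work] -/
theorem mcount_image (hi : Finset B → Bool) (ci : B → ℕ) (σ : Equiv.Perm (Fin 3)) (K : Finset (Fin 3)) :
    mcount hi ci (K.image σ) = mcount hi ci K := by
  unfold mcount
  symm
  refine card_nbij' (fun Y => fun b => (Y b).image σ) (fun Y => fun b => (Y b).image σ.symm) ?_ ?_ ?_ ?_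
  · intro Y hY
    rw [mem_coe, mem_filter] at hY ⊢
    refine ⟨mem_univ _, ?_, ?_⟩
    · funext b
      rw [card_image_perm, ← hY.2.1]
    · rw [ipat_image_comp, hY.2.2]
  · intro Y hY
    rw [mem_coe, mem_filter] at hY ⊢
    refine ⟨mem_univ _, ?_, ?_⟩
    · funext b
      rw [card_image_perm, ← hY.2.1]
    · rw [ipat_image_comp, hY.2.2, image_image]
      have : (⇑σ.symm ∘ ⇑σ) = id := by funext k; simp
      rw [this, image_id]
  · intro Y _
    funext b
    show ((Y b).image σ).image σ.symm = Y b
    rw [image_image]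
    have : (⇑σ.symm ∘ ⇑σ) = id := by funext k; simp
    rw [this, image_id]
  · intro Y _
    funext b
    show ((Y b).image σ.symm).image σ = Y b
    rw [image_image]
    have : (⇑σ ∘ ⇑σ.symm) = id := by funext k; simp
    rw [this, image_id]

/-- The block count as a function of the SIZE of the induced pattern only. [this work] -/
def mcard (hi : Finset B → Bool) (ci : B → ℕ) (s : ℕ) : ℕ := mcount hi ci (canon s)

/-- **The block count depends only on the size of the induced pattern.** [this work] -/
theorem mcount_eq_mcard (hi : Finset B → Bool) (ci : B → ℕ) (K : Finset (Fin 3)) :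
    mcount hi ci K = mcard hi ci K.card := by
  obtain ⟨σ, hσ⟩ := exists_perm_image_eq K (canon K.card) (card_canon K).symm
  unfold mcard
  rw [← hσ, mcount_image]

end Induced

/-! ## The fibre-level composition identity -/

section Identity

variable {ι : Type*} [Fintype ι] [DecidableEq ι]
variable {β : ι → Type*} [∀ i, Fintype (β i)] [∀ i, DecidableEq (β i)]

/-- The family of induced block patterns of a pattern family on the disjoint union. [this work] -/
def Gadget.ipatOf (h : Gadget β) (Y : ∀ i, β i → Finset (Fin 3)) : ι → Finset (Fin 3) := fun i => ipat (h.h i) (Y i)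

/-- Slices of hit sets are hit sets of the curried family. [this work] -/
theorem slice_hs (JJ : (Σ i, β i) → Finset (Fin 3)) (k : Fin 3) (i : ι) :
    slice (hs JJ k) i = hs (fun b => JJ ⟨i, b⟩) k := by
  ext b
  simp [hs]

/-- The hit set (of the gadget family) of a hit set (of a pattern family) is read off from the induced block patterns. [this work] -/
theorem Gadget.hits_hs (h : Gadget β) (JJ : (Σ i, β i) → Finset (Fin 3)) (k : Fin 3) :
    h.hits (hs JJ k) = hs (h.ipatOf fun i b => JJ ⟨i, b⟩) k := by
  ext i
  rw [Gadget.mem_hits, slice_hs]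
  simp [hs, Gadget.ipatOf]

/-- **The kernel term of `G ∘ h` at a pattern family is the kernel term of `G` at the induced block patterns.** [this work] -/
theorem Sunflower.KJ_compose (G : Sunflower ι) (h : Gadget β) (κ : Fin 5 → Fin 5 → Fin 5 → ℤ)
    (JJ : (Σ i, β i) → Finset (Fin 3)) :
    KJ κ (G.compose h) JJ = KJ κ G (h.ipatOf fun i b => JJ ⟨i, b⟩) := by
  simp only [KJ, Sunflower.compose_lab, Gadget.hits_hs]

/-- The fibre sum of the composition as a sum over curried pattern families with the prescribed (curried) card-profile. [this work] -/
theorem Sunflower.ZF_compose_eq_sum_pi (G : Sunflower ι) (h : Gadget β) (κ : Fin 5 → Fin 5 → Fin 5 → ℤ)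
    (c : (Σ i, β i) → ℕ) :
    ZF κ (G.compose h) c =
      ∑ Y ∈ (univ : Finset (∀ i, β i → Finset (Fin 3))).filter
          (fun Y => ∀ i, (fun b => (Y i b).card) = fun b => c ⟨i, b⟩),
        KJ κ G (h.ipatOf Y) := by
  unfold ZF
  simp_rw [Sunflower.KJ_compose]
  -- reindex along the currying equivalence
  let e : ((Σ i, β i) → Finset (Fin 3)) ≃ (∀ i, β i → Finset (Fin 3)) := Equiv.piCurry fun (_ : ι) (_ : β _) => Finset (Fin 3)
  refine sum_nbij' (fun JJ => e JJ) (fun Y => e.symm Y) ?_ ?_ ?_ ?_ ?_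
  · intro JJ hJJ
    rw [mem_filter] at hJJ ⊢
    refine ⟨mem_univ _, fun i => ?_⟩
    funext b
    have := congrFun hJJ.2 ⟨i, b⟩
    simpa [prof, e, Equiv.piCurry, Sigma.curry] using this
  · intro Y hY
    rw [mem_filter] at hY ⊢
    refine ⟨mem_univ _, ?_⟩
    funext x
    rcases x with ⟨i, b⟩
    have := congrFun (hY.2 i) b
    simpa [prof, e, Equiv.piCurry, Sigma.uncurry] using this
  · intro JJ _; exact e.symm_apply_apply JJ
  · intro Y _; exact e.apply_symm_apply Y
  · intro JJ _
    rfl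

/-- The number of curried pattern families with prescribed card-profile and prescribed induced block patterns is the product of the
block counts. [this work] -/
theorem Gadget.card_ipatOf_eq (h : Gadget β) (c : (Σ i, β i) → ℕ) (K : ι → Finset (Fin 3)) :
    #((univ : Finset (∀ i, β i → Finset (Fin 3))).filter
        fun Y => (∀ i, (fun b => (Y i b).card) = fun b => c ⟨i, b⟩) ∧ h.ipatOf Y = K) =
      ∏ i, mcount (h.h i) (fun b => c ⟨i, b⟩) (K i) := by
  have : ((univ : Finset (∀ i, β i → Finset (Fin 3))).filter
        fun Y => (∀ i, (fun b => (Y i b).card) = fun b => c ⟨i, b⟩) ∧ h.ipatOf Y = K) =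
      Fintype.piFinset fun i => (univ : Finset (β i → Finset (Fin 3))).filter
        fun Yi => (fun b => (Yi b).card) = (fun b => c ⟨i, b⟩) ∧ ipat (h.h i) Yi = K i := by
    ext Y
    simp only [mem_filter, mem_univ, true_and, Fintype.mem_piFinset]
    constructor
    · rintro ⟨h1, h2⟩ i
      exact ⟨h1 i, by rw [← h2]; rfl⟩
    · intro hY
      refine ⟨fun i => (hY i).1, ?_⟩
      funext i; exact (hY i).2
  rw [this, Fintype.card_piFinset]
  rfl

/-- **FIBRE-LEVEL COMPOSITION IDENTITY.** Every fibre sum of a block substitution is a block-count-weighted sum of the kernel terms of the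
outer sunflower: `ZF κ (G ∘ h) c = Σ_K (Π_i mcard (h i) (c|_i) |K i|) · KJ κ G K`. [this work] -/
theorem Sunflower.ZF_compose_eq (G : Sunflower ι) (h : Gadget β) (κ : Fin 5 → Fin 5 → Fin 5 → ℤ) (c : (Σ i, β i) → ℕ) :
    ZF κ (G.compose h) c =
      ∑ K : ι → Finset (Fin 3), (∏ i, (mcard (h.h i) (fun b => c ⟨i, b⟩) ((K i).card) : ℤ)) * KJ κ G K := by
  rw [Sunflower.ZF_compose_eq_sum_pi]
  rw [← sum_fiberwise_of_maps_to (g := h.ipatOf) (t := univ) (fun Y _ => mem_univ _)]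
  refine sum_congr rfl fun K _ => ?_
  rw [filter_filter]
  rw [sum_congr rfl (fun Y hY => show KJ κ G (h.ipatOf Y) = KJ κ G K by rw [(mem_filter.1 hY).2.2]),
    sum_const, nsmul_eq_mul, h.card_ipatOf_eq]
  push_cast
  congr 1
  refine prod_congr rfl fun i _ => ?_
  rw [mcount_eq_mcard]

/-- The fibre-level composition identity regrouped by profile: `ZF κ (G ∘ h) c = Σ_k (Π_i mcard (h i) (c|_i) (k i)) · ZF κ G k`.
[this work] -/
theorem Sunflower.ZF_compose_eq_sum_ZF (G : Sunflower ι) (h : Gadget β) (κ : Fin 5 → Fin 5 → Fin 5 → ℤ) (c : (Σ i, β i) → ℕ) :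
    ZF κ (G.compose h) c =
      ∑ k ∈ (univ : Finset (ι → Finset (Fin 3))).image prof,
        (∏ i, (mcard (h.h i) (fun b => c ⟨i, b⟩) (k i) : ℤ)) * ZF κ G k := by
  rw [Sunflower.ZF_compose_eq]
  rw [← sum_fiberwise_of_maps_to (s := univ) (t := univ.image prof) (g := prof) (fun K _ => mem_image_of_mem _ (mem_univ K))]
  refine sum_congr rfl fun k _ => ?_
  unfold ZF
  rw [mul_sum]
  refine sum_congr rfl fun K hK => ?_
  rw [mem_filter] at hK
  rw [← hK.2]
  rfl

/-- **COMB IS SUBSTITUTION-CLOSED**: if every fibre sum of `G` is nonnegative then so is every fibre sum of every block substitution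
`G ∘ h` of monotone Boolean gadgets into `G` (kernel-generic). [this work] -/
theorem Sunflower.ZF_compose_nonneg_of_comb (G : Sunflower ι) (h : Gadget β) (κ : Fin 5 → Fin 5 → Fin 5 → ℤ)
    (hc : ∀ k : ι → ℕ, 0 ≤ ZF κ G k) (c : (Σ i, β i) → ℕ) :
    0 ≤ ZF κ (G.compose h) c := by
  rw [Sunflower.ZF_compose_eq_sum_ZF]
  refine sum_nonneg fun k _ => mul_nonneg ?_ (hc k)
  exact prod_nonneg fun i _ => by exact_mod_cast Nat.zero_le _

/-- `COMB` in the finite (`Fin 4`-profile) form is substitution-closed. [this work] -/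
theorem Sunflower.comb_compose_of_comb (G : Sunflower ι) (h : Gadget β) (κ : Fin 5 → Fin 5 → Fin 5 → ℤ)
    (hc : ∀ k : ι → Fin 4, 0 ≤ ZF κ G (fun i => ((k i : Fin 4) : ℕ))) (c : (Σ i, β i) → Fin 4) :
    0 ≤ ZF κ (G.compose h) (fun x => ((c x : Fin 4) : ℕ)) :=
  G.ZF_compose_nonneg_of_comb h κ (comb_of_fin_four κ G hc) _

end Identity

/-! ## Instances: all fibres of every product-type and star-type composition -/

section Instances

variable {β : Fin 3 → Type*} [∀ i, Fintype (β i)] [∀ i, DecidableEq (β i)]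

/-- COMB_H, COMB_G, COMB_T on every PRODUCT-type composition `θ ∘ h` (all tensor-Bernstein coefficients of the three rows are
nonnegative there, not only the partition coefficient of gen 9). [this work] -/
theorem comb_prodOuter_compose (h : Gadget β) (c : (Σ i, β i) → ℕ) :
    0 ≤ ZF s6H (prodOuter.compose h) c ∧ 0 ≤ ZF s6G (prodOuter.compose h) c ∧ 0 ≤ ZF s6T (prodOuter.compose h) c :=
  ⟨prodOuter.ZF_compose_nonneg_of_comb h s6H (comb_of_fin_four s6H prodOuter comb_prodOuter_H) c,
   prodOuter.ZF_compose_nonneg_of_comb h s6G (comb_of_fin_four s6G prodOuter comb_prodOuter_G) c,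
   prodOuter.ZF_compose_nonneg_of_comb h s6T (comb_of_fin_four s6T prodOuter comb_prodOuter_T) c⟩

/-- COMB_H, COMB_G, COMB_T on every STAR-type composition `θ' ∘ h`. [this work] -/
theorem comb_starOuter_compose (h : Gadget β) (c : (Σ i, β i) → ℕ) :
    0 ≤ ZF s6H (starOuter.compose h) c ∧ 0 ≤ ZF s6G (starOuter.compose h) c ∧ 0 ≤ ZF s6T (starOuter.compose h) c :=
  ⟨starOuter.ZF_compose_nonneg_of_comb h s6H (comb_of_fin_four s6H starOuter comb_starOuter_H) c,
   starOuter.ZF_compose_nonneg_of_comb h s6G (comb_of_fin_four s6G starOuter comb_starOuter_G) c,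
   starOuter.ZF_compose_nonneg_of_comb h s6T (comb_of_fin_four s6T starOuter comb_starOuter_T) c⟩

end Instances


end Summit.CriticalPhenomena.PercolationContinuityZ3.Theorems.SunflowerPartition
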